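import Literature.NumberTheory.EllipticCurves.Smith2016.CongruentNumberGenusDeterminantRowOne
import Literature.NumberTheory.EllipticCurves.Smith2016.CongruentNumberRedeiDeterminant
import Literature.NumberTheory.EllipticCurves.CongruentNumberMonskySelmerParityBound
import Literature.NumberTheory.EllipticCurves.CongruentNumberMonskySelmerParitySelmer
import HarnessLib

/-!
# Smith 2016 Thm. 1.2 and Tian–Yuan–Zhang (journal) Thm. 1.2 on `n ≡ 1 (mod 8)`, RELATIVE TO ONE FINITE `𝔽₂`-IDENTITY (`smith_thm22_rowOne`: `ℒ₁(n) = det M₁`), and that identity DISCHARGED for one prime factor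

Topic `NumberTheory/EllipticCurves`, namespace `Literature.NumberTheory.EllipticCurves.Smith2016`.
A pure proof file (theorems only).  It composes three tree theorems of the cell `bsd-monsky` —
`CongruentNumberSmithMatrixSelmer` (`#Sel⁽²⁾(E⁽ⁿ⁾) = 4 ⟺ rank E⁽ⁿ⁾(ℚ) = 0 ∧ Ш(E⁽ⁿ⁾)[2^∞] = 0 ⟺ det M₁ = 1`,
Monsky's formula with equality + the exact descent count), `CongruentNumberRedeiDeterminant` (Smith's
Table 2: `g(d) ≡ det(A | z)`, Rédei–Reichardt) — with the named fact `smith_thm22_rowOne` (Smith 2016,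
Thm. 2.2 row `1`: `ℒ₁(n) ≡ det M₁ (mod 2)`, a finite identity between Legendre symbols) and, for Smith's own
Theorem 1.2, with Tian–Yuan–Zhang's Theorem 1.1 (`TianYuanZhang2017.thm11_parity_of_scriptL`).

## The statements (verbatim sources in the docstrings of the two fact files)

* Smith 2016, Conj. 1.1 / Thm. 1.2 (arXiv:1603.08479 chunk p0003 L9–L31): "`ℒ(E)` is an odd integer if and
  only if the `2`-Selmer group `Sel⁽²⁾(E)` is generated by the image of `E(ℚ)[2]`" — "true for all
  quadratic twists of the congruent number curve"; proof (chunk p0005 L65–L75): Thm. 2.1 (= TYZ Thm. 1.1: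
  `ℒ(E⁽ⁿ⁾) ≡ ℒ₁(n)`) + Thm. 2.2 (`ℒ₁(n) = det M₁`) + Monsky (`rk Sel⁽²⁾ = 2 + crnk M₁`).
* Tian–Yuan–Zhang, Asian J. Math. 21 (2017), **Thm. 1.2 (journal numbering; "(Alexander Smith [25], Theorem
  4.1 and Corollary 4.2)")**: "For `n ≡ 1, 2, 3 (mod 8)`, the following conditions are equivalent:
  • `rank_ℤ E_n(ℚ) = 0` and `Ш(E_n)[2^∞] = 0`; • `Σ_{n = d₀d₁⋯d_ℓ, dᵢ ≡ 1 (mod 8), i > 0} ∏ᵢ g(dᵢ) ≡ 1 (mod 2)`."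

## What is proved here (every `k`; `n = p₁⋯p_k ≡ 1 (mod 8)`, distinct odd primes; `g(d) = #2Cl(ℚ(√−d))`)

Relative to `h22 : smith_thm22_rowOne` ALONE (no `L`-function, no Gross–Zagier–Kolyvagin, no BSD input):
* `odd_genusSum₁_iff_det_of_smith` — `Σ∏g(dᵢ)` odd `⟺ det M₁ = 1`;
* **`card_selmerGroup_two_eq_four_iff_odd_genusSum₁_of_smith`** — `#Sel⁽²⁾(E⁽ⁿ⁾/ℚ) = 4 ⟺ Σ∏g(dᵢ)` odd;
* **`rank_zero_and_sha_iff_odd_genusSum₁_of_smith`** — TYZ (journal) Thm. 1.2 on `n ≡ 1 (mod 8)`: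
  `rank E⁽ⁿ⁾(ℚ) = 0 ∧ Ш(E⁽ⁿ⁾/ℚ)[2^∞] = 0 ⟺ Σ∏g(dᵢ)` odd; and its enumeration-free form
  `rank_zero_and_sha_iff_odd_genusSum₁_of_smith'` for every square-free `N ≡ 1 (mod 8)`.
Relative to `{h11 : thm11_parity_of_scriptL, h22}`:
* **`exists_scriptL_odd_iff_card_selmerGroup_two_eq_four_of_smith`** — Smith's Thm. 1.2 on `n ≡ 1 (mod 8)`:
  TYZ's integer `𝓛(n)` is odd iff `#Sel⁽²⁾(E⁽ⁿ⁾/ℚ) = 4` (iff rank `0` and `Ш[2^∞] = 0`).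
Unconditionally:
* **`smith_thm22_rowOne_prime`** — the identity for `k = 1` (`n = p ≡ 1 (mod 8)`: `ℒ₁(p) = g(p)` is even,
  `det M₁ = 0` as `s(p) = 2`), i.e. `smith_thm22_rowOne` restricted to one prime factor HOLDS;
* **`mordellWeilRank_pos_or_sha_ne_bot_prime_one_mod_eight`** — for every prime `p ≡ 1 (mod 8)`, `E⁽ᵖ⁾` has
  positive rank or non-trivial `Ш[2^∞]` (`s(p) = 2`, Monsky exact + descent count).

Cell `bsd-monsky` (prover-B g17).  AI provenance: written by an AI assistant; no human has reviewed it.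

## References
* [Smith2016CongruentDensity] A. Smith, arXiv:1603.08479v2, §1 Conj. 1.1 / Thm. 1.2 / Cor. 1.3 (chunk p0003
  L9–L44), §2 Thm. 2.1, Thm. 2.2, proof of Thm. 1.2 (chunk p0005 L48–L75).
* [TianYuanZhang2017] Asian J. Math. 21 (2017), Thm. 1.1; Thm. 1.2 (journal numbering) = Smith Thm. 4.1 /
  Cor. 4.2.
* [HeathBrown1994SelmerCongruentII] Appendix (Monsky), typescript p. 39 L10–L33; §1 p. 6 L26–L28 (`s(p)`).
* [SilvermanAEC2009] Thm. X.4.2.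
-/

open scoped Classical

open Matrix Finset
open Literature.NumberTheory.EllipticCurves.HeathBrown1994
open Literature.NumberTheory.EllipticCurves.MonskySelmerParity
open Literature.NumberTheory.EllipticCurves.TianYuanZhang2017

namespace Literature.NumberTheory.EllipticCurves.Smith2016

section RelativeToTheIdentity

variable {k : ℕ} (p : Fin k → ℕ)

/-- **`ℒ₁(n)` odd `⟺ det M₁ = 1`**, relative to Smith's Thm. 2.2 row `1`.
[cite: Smith2016CongruentDensity, Thm. 2.2 (chunk p0005 L59–L63)] -/
theorem odd_genusSum₁_iff_det_of_smith (h22 : smith_thm22_rowOne) (hp : ∀ i, (p i).Prime)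
    (hodd : ∀ i, Odd (p i)) (hinj : Function.Injective p) (h8 : (∏ i, p i) % 8 = 1) :
    Odd (genusSum₁ (∏ i, p i) fun d => genusClassNumber (GenusField d)) ↔
      (Matrix.fromBlocks (legendreMatrix p + (legendreMatrix p)ᵀ) (legendreMatrix p)ᵀ
        (legendreMatrix p) (legendreDiagonal p 2)).det = 1 := by
  rw [← ZMod.natCast_eq_one_iff_odd, h22 k p hp hodd hinj h8]

/-- **`#Sel⁽²⁾(E⁽ⁿ⁾/ℚ) = 4 ⟺ Σ∏g(dᵢ)` odd** for `n = p₁⋯p_k ≡ 1 (mod 8)`, relative to Smith's Thm. 2.2 row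
`1` only (Monsky's formula with equality is a tree theorem).
[cite: Smith2016CongruentDensity, §2 proof of Thm. 1.2 (chunk p0005 L65–L75)]
[cite: HeathBrown1994SelmerCongruentII, Appendix (Monsky), typescript p. 39 L10–L33] -/
theorem card_selmerGroup_two_eq_four_iff_odd_genusSum₁_of_smith (h22 : smith_thm22_rowOne)
    (hp : ∀ i, (p i).Prime) (hodd : ∀ i, Odd (p i)) (hinj : Function.Injective p)
    (h8 : (∏ i, p i) % 8 = 1) :
    Nat.card ((congruentNumberCurve (∏ i, p i)).selmerGroup 2) = 4 ↔
      Odd (genusSum₁ (∏ i, p i) fun d => genusClassNumber (GenusField d)) := by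
  rw [card_selmerGroup_two_eq_four_iff_det_smithMatrixOne p hp hodd hinj (by omega),
    odd_genusSum₁_iff_det_of_smith p h22 hp hodd hinj h8]

/-- **Tian–Yuan–Zhang (journal) Thm. 1.2 = Smith Thm. 4.1 / Cor. 4.2 on `n ≡ 1 (mod 8)`, RELATIVE TO THE
IDENTITY `ℒ₁(n) = det M₁` ALONE**: for `n = p₁⋯p_k ≡ 1 (mod 8)`,
`rank E⁽ⁿ⁾(ℚ) = 0 ∧ Ш(E⁽ⁿ⁾/ℚ)[2^∞] = 0 ⟺ Σ_{n = d₀⋯d_ℓ, dᵢ ≡ 1 (8)} ∏ᵢ g(dᵢ)` is odd.  No `L`-function enters: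
Monsky exact + the descent count both ways + Rédei–Reichardt are tree theorems.
[cite: TianYuanZhang2017, Thm. 1.2 (journal numbering: "Alexander Smith, Theorem 4.1 and Corollary 4.2")]
[cite: Smith2016CongruentDensity, Thm. 1.2 and Thm. 2.2 (chunk p0003 L29–L31, p0005 L59–L75)] -/
theorem rank_zero_and_sha_iff_odd_genusSum₁_of_smith (h22 : smith_thm22_rowOne) (hp : ∀ i, (p i).Prime)
    (hodd : ∀ i, Odd (p i)) (hinj : Function.Injective p) (h8 : (∏ i, p i) % 8 = 1) :
    ((haveI := isElliptic_congruentNumberCurve (Squarefree.ne_zero (squarefree_prod_of_injective p hp hinj));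
        (congruentNumberCurve (∏ i, p i)).mordellWeilRank = 0) ∧
      (haveI := isElliptic_congruentNumberCurve (Squarefree.ne_zero (squarefree_prod_of_injective p hp hinj));
        AddCommGroup.primaryComponent (congruentNumberCurve (∏ i, p i)).sha 2 = ⊥)) ↔
      Odd (genusSum₁ (∏ i, p i) fun d => genusClassNumber (GenusField d)) := by
  rw [rank_zero_and_sha_iff_det_smithMatrixOne p hp hodd hinj (by omega),
    odd_genusSum₁_iff_det_of_smith p h22 hp hodd hinj h8]

/-- **Smith 2016, Thm. 1.2 on `n ≡ 1 (mod 8)`, relative to {TYZ Thm. 1.1, the identity `ℒ₁(n) = det M₁`}**: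
TYZ's integer `𝓛(n)` (`IsScriptL`: `𝓛(n)² = L(E_n,1)/(2^{2k−2−a}Ω)` or `0`) is odd iff
`#Sel⁽²⁾(E⁽ⁿ⁾/ℚ) = 4` ("`ℒ(E)` is an odd integer iff `Sel⁽²⁾(E)` is generated by the image of `E(ℚ)[2]`").
[cite: Smith2016CongruentDensity, Thm. 1.2 with its proof (chunk p0003 L29–L31, p0005 L65–L75)]
[cite: TianYuanZhang2017, Thm. 1.1] -/
theorem exists_scriptL_odd_iff_card_selmerGroup_two_eq_four_of_smith (h11 : thm11_parity_of_scriptL)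
    (h22 : smith_thm22_rowOne) (hp : ∀ i, (p i).Prime) (hodd : ∀ i, Odd (p i))
    (hinj : Function.Injective p) (h8 : (∏ i, p i) % 8 = 1) :
    ∃ L : ℤ, IsScriptL (∏ i, p i) L ∧
      (Odd L ↔ Nat.card ((congruentNumberCurve (∏ i, p i)).selmerGroup 2) = 4) := by
  obtain ⟨L, hL, hpar⟩ := h11 (∏ i, p i) (squarefree_prod_of_injective p hp hinj) (Or.inl h8) GenusField
    (isGenusFieldFamily_genusField _)
  refine ⟨L, hL, ?_⟩
  rw [← ZMod.intCast_eq_one_iff_odd, hpar, h22 k p hp hodd hinj h8,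
    card_selmerGroup_two_eq_four_iff_det_smithMatrixOne p hp hodd hinj (by omega)]

/-- Smith's Thm. 1.2 on `n ≡ 1 (mod 8)` in the rank/`Ш` form: `𝓛(n)` odd iff rank `0` and `Ш[2^∞] = 0`,
relative to {TYZ Thm. 1.1, the identity}.  [cite: Smith2016CongruentDensity, Thm. 1.2 and Cor. 1.3 (chunk p0003 L29–L44)]
[cite: TianYuanZhang2017, Thm. 1.1 and Cor. 1.3 (journal numbering)] -/
theorem exists_scriptL_odd_iff_rank_zero_and_sha_of_smith (h11 : thm11_parity_of_scriptL)
    (h22 : smith_thm22_rowOne) (hp : ∀ i, (p i).Prime) (hodd : ∀ i, Odd (p i))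
    (hinj : Function.Injective p) (h8 : (∏ i, p i) % 8 = 1) :
    ∃ L : ℤ, IsScriptL (∏ i, p i) L ∧
      (Odd L ↔
        (haveI := isElliptic_congruentNumberCurve (Squarefree.ne_zero (squarefree_prod_of_injective p hp hinj));
          (congruentNumberCurve (∏ i, p i)).mordellWeilRank = 0) ∧
        (haveI := isElliptic_congruentNumberCurve (Squarefree.ne_zero (squarefree_prod_of_injective p hp hinj));
          AddCommGroup.primaryComponent (congruentNumberCurve (∏ i, p i)).sha 2 = ⊥)) := by
  obtain ⟨L, hL, h⟩ := exists_scriptL_odd_iff_card_selmerGroup_two_eq_four_of_smith p h11 h22 hp hodd hinj h8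
  refine ⟨L, hL, ?_⟩
  rw [h, card_selmerGroup_two_eq_four_iff_rank_zero_and_sha
    (Squarefree.ne_zero (squarefree_prod_of_injective p hp hinj))]

end RelativeToTheIdentity

/-! ## §2 Enumeration-free form: every square-free `N ≡ 1 (mod 8)` -/

/-- **TYZ (journal) Thm. 1.2 on `n ≡ 1 (mod 8)` for every square-free `N`, relative to the identity alone**:
`rank E_N(ℚ) = 0 ∧ Ш(E_N/ℚ)[2^∞] = 0 ⟺ Σ∏g(dᵢ)` odd.
[cite: TianYuanZhang2017, Thm. 1.2 (journal numbering)] [cite: Smith2016CongruentDensity, Thm. 1.2, Thm. 2.2] -/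
theorem rank_zero_and_sha_iff_odd_genusSum₁_of_smith' (h22 : smith_thm22_rowOne) {N : ℕ}
    (hN : Squarefree N) (h8 : N % 8 = 1) :
    ((haveI := isElliptic_congruentNumberCurve (Squarefree.ne_zero hN);
        (congruentNumberCurve N).mordellWeilRank = 0) ∧
      (haveI := isElliptic_congruentNumberCurve (Squarefree.ne_zero hN);
        AddCommGroup.primaryComponent (congruentNumberCurve N).sha 2 = ⊥)) ↔
      Odd (genusSum₁ N fun d => genusClassNumber (GenusField d)) := by
  have hNodd : Odd N := Nat.odd_iff.mpr (by omega)
  obtain ⟨k, p, hp, hp2, hinj, hprod⟩ := exists_odd_prime_family_of_squarefree hN hNodd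
  have hodd : ∀ i, Odd (p i) := fun i => (hp i).odd_of_ne_two (hp2 i)
  subst hprod
  exact rank_zero_and_sha_iff_odd_genusSum₁_of_smith p h22 hp hodd hinj h8

/-- **`#Sel⁽²⁾(E_N/ℚ) = 4 ⟺ Σ∏g(dᵢ)` odd** for every square-free `N ≡ 1 (mod 8)`, relative to the identity
alone. [cite: Smith2016CongruentDensity, Thm. 1.2 and Thm. 2.2 (chunk p0005 L59–L75)] -/
theorem card_selmerGroup_two_eq_four_iff_odd_genusSum₁_of_smith' (h22 : smith_thm22_rowOne) {N : ℕ}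
    (hN : Squarefree N) (h8 : N % 8 = 1) :
    Nat.card ((congruentNumberCurve N).selmerGroup 2) = 4 ↔
      Odd (genusSum₁ N fun d => genusClassNumber (GenusField d)) := by
  rw [card_selmerGroup_two_eq_four_iff_rank_zero_and_sha (Squarefree.ne_zero hN)]
  exact rank_zero_and_sha_iff_odd_genusSum₁_of_smith' h22 hN h8

/-! ## §3 One prime factor: the identity HOLDS for `k = 1`; `E⁽ᵖ⁾`, `p ≡ 1 (mod 8)`, has rank `> 0` or `Ш[2^∞] ≠ 0` -/

section OnePrime

/-- `∏ (![q]) = q`. [cite: HeathBrown1994SelmerCongruentII, §1 typescript p. 6 L26–L28 (one prime factor)] -/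
theorem prod_vec_one (q : ℕ) : ∏ i, (![q] : Fin 1 → ℕ) i = q := by
  rw [Fin.prod_univ_succ, Fin.prod_univ_zero, mul_one]; rfl

/-- **`det M₁ = 0` for a prime `p ≡ 1 (mod 8)`**: `s(p) = 2` (Heath-Brown's one-prime table, tree theorem
`monskySelmerRankOdd_prime`), so `M₁` (`= (0)` indeed) is singular.
[cite: HeathBrown1994SelmerCongruentII, §1 typescript p. 6 L26–L28] [cite: Smith2016CongruentDensity, §2 (chunk p0005 L65–L69)] -/
theorem det_smithMatrixOne_prime_eq_zero {q : ℕ} (hq : q.Prime) (h8 : q % 8 = 1) :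
    (Matrix.fromBlocks (legendreMatrix ![q] + (legendreMatrix ![q])ᵀ) (legendreMatrix ![q])ᵀ
        (legendreMatrix ![q]) (legendreDiagonal ![q] 2)).det = 0 := by
  have hq2 : q ≠ 2 := by rintro rfl; norm_num at h8
  have hodd : ∀ i, Odd ((![q] : Fin 1 → ℕ) i) := fun i => by fin_cases i; exact hq.odd_of_ne_two hq2
  have hprime : ∀ i, ((![q] : Fin 1 → ℕ) i).Prime := fun i => by fin_cases i; exact hq
  have hinj : Function.Injective (![q] : Fin 1 → ℕ) := Function.injective_of_subsingleton _
  have h4 : (∏ i, (![q] : Fin 1 → ℕ) i) % 4 = 1 := by rw [prod_vec_one]; omega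
  rw [det_eq_zero_iff_ne_one, Ne,
    ← monskySelmerRankOdd_eq_zero_iff_det_smithMatrixOne ![q] hprime hodd hinj h4,
    monskySelmerRankOdd_prime hq hq2, if_pos h8]
  decide

/-- **Smith's Thm. 2.2 row `1` HOLDS for one prime factor**: for a prime `p ≡ 1 (mod 8)`,
`ℒ₁(p) = g(p) ≡ 0 = det M₁ (mod 2)` (`g(p)` even: `Cl(ℚ(√−p))` has an element of order `4`;
`det M₁ = 0`: `s(p) = 2`). [cite: Smith2016CongruentDensity, Thm. 2.2 (chunk p0005 L59–L63)]
[cite: HeathBrown1994SelmerCongruentII, §1 typescript p. 6 L26–L28] -/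
theorem smith_thm22_rowOne_prime {q : ℕ} (hq : q.Prime) (h8 : q % 8 = 1) :
    ((genusSum₁ q (fun d => genusClassNumber (GenusField d)) : ℕ) : ZMod 2) =
      (Matrix.fromBlocks (legendreMatrix ![q] + (legendreMatrix ![q])ᵀ) (legendreMatrix ![q])ᵀ
        (legendreMatrix ![q]) (legendreDiagonal ![q] 2)).det := by
  rw [det_smithMatrixOne_prime_eq_zero hq h8, genusSum₁_eq_self hq.one_lt (fun d hd h1 hlt => ?_),
    ZMod.natCast_eq_zero_iff_even]
  · exact even_genusClassNumber_genusField_prime hq h8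
  · -- a prime has no divisor strictly between `1` and itself
    exfalso
    rcases (Nat.dvd_prime hq).mp hd with rfl | rfl <;> omega

/-- **`smith_thm22_rowOne` restricted to `k = 1` holds** (the fact's own binder shape).
[cite: Smith2016CongruentDensity, Thm. 2.2 (chunk p0005 L59–L63)] -/
theorem smith_thm22_rowOne_of_one (p : Fin 1 → ℕ) (hp : ∀ i, (p i).Prime) (h8 : (∏ i, p i) % 8 = 1) :
    ((genusSum₁ (∏ i, p i) (fun d => genusClassNumber (GenusField d)) : ℕ) : ZMod 2) =
      (Matrix.fromBlocks (legendreMatrix p + (legendreMatrix p)ᵀ) (legendreMatrix p)ᵀ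
        (legendreMatrix p) (legendreDiagonal p 2)).det := by
  have hpe : p = ![p 0] := by ext i; fin_cases i; rfl
  have hprod : ∏ i, p i = p 0 := by rw [Fin.prod_univ_succ, Fin.prod_univ_zero, mul_one]
  rw [hprod] at h8 ⊢
  rw [hpe]
  simpa using smith_thm22_rowOne_prime (hp 0) h8

/-- **For every prime `p ≡ 1 (mod 8)`, `E⁽ᵖ⁾ : y² = x³ − p²x` has positive Mordell–Weil rank or a
non-trivial `2`-primary Tate–Shafarevich group** — unconditionally (`s(p) = 2`: `#Sel⁽²⁾(E⁽ᵖ⁾/ℚ) = 16`,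
and `#Sel₂ = 4 ⟺` rank `0 ∧ Ш[2^∞] = 0`).  Which alternative holds is NOT decided by a first descent
(e.g. `p = 17, 73, 89, 97`: rank `0`, `Ш[2] ≅ (ℤ/2)²`; `p = 41, 137`: rank `2`).
[cite: HeathBrown1994SelmerCongruentII, §1 typescript p. 6 L26–L28 (s(p) = 2 for p ≡ 1 (mod 8))]
[cite: SilvermanAEC2009, Thm. X.4.2] -/
theorem mordellWeilRank_pos_or_sha_ne_bot_prime_one_mod_eight {q : ℕ} (hq : q.Prime) (h8 : q % 8 = 1) :
    (haveI := isElliptic_congruentNumberCurve hq.ne_zero; 0 < (congruentNumberCurve q).mordellWeilRank) ∨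
      (haveI := isElliptic_congruentNumberCurve hq.ne_zero;
        AddCommGroup.primaryComponent (congruentNumberCurve q).sha 2 ≠ ⊥) := by
  have hq2 : q ≠ 2 := by rintro rfl; norm_num at h8
  have hodd : ∀ i, Odd ((![q] : Fin 1 → ℕ) i) := fun i => by fin_cases i; exact hq.odd_of_ne_two hq2
  have hprime : ∀ i, ((![q] : Fin 1 → ℕ) i).Prime := fun i => by fin_cases i; exact hq
  have hinj : Function.Injective (![q] : Fin 1 → ℕ) := Function.injective_of_subsingleton _
  have hsel : ¬ Nat.card ((congruentNumberCurve q).selmerGroup 2) = 4 := by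
    rw [card_selmerGroup_two_eq_four_iff_det_smithMatrixOne' ![q] (prod_vec_one q) hprime hodd hinj
      (by omega), det_smithMatrixOne_prime_eq_zero hq h8]
    exact zero_ne_one
  rw [card_selmerGroup_two_eq_four_iff_rank_zero_and_sha hq.ne_zero, not_and_or] at hsel
  rcases hsel with h | h
  · exact Or.inl (Nat.pos_of_ne_zero h)
  · exact Or.inr h

end OnePrime

end Literature.NumberTheory.EllipticCurves.Smith2016
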